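/- Copyright: the b2b-balaban cell (near-miss cell 7), T⁴-continuum fan-out, lineage t4-ne7b-formalise-leaf-06 (NE7b CRUX
TEAM (2) leaf prover 06), gen 36: IR-51-1 part 2∕2 «THE PER-LEVEL-BOX VOLUME DISPLAYS» (supply module); gen 37: v1.2 DOCFIX of the
CENSUS NOTE only (VOLUME-4 served, refuter P-v21-2, OWNER R-OWNER-52-1 (3)) — code byte-identical to v1.1.  Released under the licence
of the surrounding project. -/
import Summits.QuantumFields.BalabanUV.T4Continuum.Support.HistoryBankingVolumeWindowCollar
import Summits.QuantumFields.BalabanUV.T4Continuum.Support.HistoryBankingShrunkLedger82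

/-!
# History banking, M5-2e supplier, part 2∕2: THE PER-LEVEL-BOX VOLUME DISPLAYS `VolumeDisplaysS82` — the OWNER's (E4)
`HistoryBankingShrunkLedger82.shrunk82_volume_le_lifeCost` volume binders VERBATIM — and the slack filler `huθS82` at the weight of
record `cvol82 d j Γ`, DISCHARGED AT BOTH LETTERS on ONE window ∕ ONE threshold each (route R-P1 of row NE7b; INTERFACE REQUEST NE7b
IR-51-1 of t4-ne7b-p1 g51, RULING R-OWNER-51-1 (3)∕(5) «M5-2e THE PER-LEVEL DEAD BOX»; supply module only)

Summits-side support leaf of the T⁴-continuum cell (rung (B)+1 on a FINITE torus only; NOT infinite volume, NOT the mass gap,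
NOT the Clay statement; NOT a proof of the spine estimate NE7b — the cell's OWN estimate, NOT PRINTED, NOT PROVED).  [folklore]
INSTANTIATION BY NAME of part 1 `HistoryBankingVolumeWindowCollar` (`VolumeDisplaysP`, `jlag`, `VolumeWindowP(L)`, `ellVolP(L)`, the
`(σ, c, a)`-parametric fillers) at M5-2e's letters — collar `σ := 6·collar82 d`, lag-clause constant `c := feed82 d` (the OWNER's (E2)
`HistoryBankingAnchors82`), slack weight `a := cvol82 d j Γ` (the OWNER's (E4) `HistoryBankingShrunkLedger82`, imported for `cvol82` ∕
`cvol82_pos` only); no `[cite:]` tag, nothing printed asserted, no `def … : Prop`, zero `sorry`; nothing is re-proved.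

WHAT (IR-51-1 (i)–(iv) to the letter).  (i) **`VolumeDisplaysS82 C d K R u Γ j := VolumeDisplaysP C d K R u Γ j (6·collar82 d) (feed82 d)`**
— its eight projections `hu ∕ hΓ0 ∕ hΓ ∕ hj1 ∕ hsmall ∕ huS ∕ huE₂ ∕ huE₃` read `hsmall : feed82 d * Γ ≤ 2 ^ j / 2`, `huS : ∀ t, t ≤ K →
u t * (6 * collar82 d) ≤ floorK C K R t`, … = `shrunk82_volume_le_lifeCost`'s binders in ORDER (positional for (E5)
`credit_mul_volume_le_shapeTH_shrunk82`).  (ii) the slack filler at `cvol82`: per cube **`huθS82_uvol`**, and over events in BOTH shapes —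
GUARDED `huθS82(L)_events_of_log_eq_of_inInterval : ∀ e ∈ E, (sh e).kind = 0 → (sh e).step ≤ K → cvol82 … * log Λ_{(sh e).step} ≤ θᵥ·p₀(…)²`
(IR-51-1 (ii) verbatim) and WITNESS `huθS82(L)_births_of_log_eq_of_inInterval` (`hsteps` separately, no guard in the conclusion — (E5)'s `huθ`
binder and the L-record's `huV` field).  (iii) instances at both letters: per cube `u := uvol cΛ g K`, `Γ := 1 + β₀`, **`j := jvol82 d (1+β₀)`**
(`jvol82 d Γ := jlag (feed82 d) Γ`, the least `j` with `feed82 d·Γ ≤ 2^j∕2`: `hsmall_jvol82`); lattice `u := uvolL cΛ M d g R K`,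
`Γ := (1+β₀)·L^d`, `j := jvol82 d Γ`; windows `VolumeWindowP … (cvol82 d j Γ) (6·collar82 d)` ∕ `VolumeWindowPL …` ((WS1⁸²)
`6·collar82 d·cΛ ≤ E₂·ℓ^{κ₂}`, (WS4⁸²) `cvol82 …·cΛ ≤ θᵥ·A₀²·ℓ^{κᵥ}`; lattice at `cΛM^d` ∕ `cΛ(LM)^d`): **`volumeDisplaysS82_uvol(_of_isRj)`**,
**`volumeDisplaysS82L_uvolL(_of_isRj)`**.  (iv) ONE threshold each, **`ellVolS82 C d κ₂ κᵥ cΛ θv Γ j := ellVolP … (cvol82 d j Γ) (6·collar82 d)`**,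
**`ellVolS82L`** (read at `(1+β₀, jvol82 d (1+β₀))` resp. the lattice pair — IR-48-2's `ellVol … Lu jl` convention the LW record already
uses), and the record-facing fillers
**`volumeDisplaysS82(L)_of_log_eq_of_inInterval`** + the four `huθS82…` above, all from `Flow.InInterval γ K` with `γ ≤ e^{−ℓ∕2}`.

CENSUS NOTE (the OWNER's R-OWNER-51-1 (1)∕(3) and IR-51-1; the desk floats below are CERTIFIED — balaban-calc GRAMMAR v76∕v77 G40
«VOLUME-4 FIRM — SERVED» on the landed bytes of (E4) and of this file, calc-ref §42 countersigned; constants SYMBOLIC in the kernel,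
trigger c2∕c6).  Reading (A), lattice letter, `E₂ = c_{E₂}M^d64^d`: (WS1⁸²ᴸ) threshold `ℓ ≥ (6·collar82 4∕64⁴)·ρ = 361.46·ρ`
(`ρ = cΛ∕c_{E₂}`; `6·collar82 4∕64⁴ = 3 032 184 375∕2²³ = 361.4645…`, kernel bracket `361.464 < · < 361.465` in leaf-06's X-read of
(E2)) — NIL iff `ρ ≤ 1.2067` (m′ = 1) … `1.5632` (m′ = 6): NIL AT RATIO ONE but THIN, +0.08 … +0.19 orders (the WALL's wording,
W-ne7bp1-g51-3; M5-2d: `5.6676·10⁵·ρ`, vacuous by 3.11 orders); (WS4⁸²ᴸ) root `(cvol82·cΛ(LM)^d∕θᵥA₀²)^{1∕37}` harmless (37th-root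
branch: `B₅′ = (cvol82·13⁸)^{1∕37} ≈ 6.06–6.08`, room `≥ 10^{68.6}` at ρ-class one, NO new window class — G40 (vi); v1.1's «room of the
order 10²³» named M5-2d's (WS4ᴸ) COEFFICIENT class `cvolᴸ ≈ 2·10²³`, not a room — refuter PRICING-NE7b v21 P-v21-2 ∕ S-v21-2, corrected
here); weight `cvol82(4, 66, 13⁴) = 1.089·10²⁰`; lags `jvol82 4 (1+β₀) = 51` per cube (52 only beyond `1 + β₀ = 1.2585`),
`jvol82 4 ((1+β₀)13⁴) = 66` in lattice units EXACTLY while `β₀ ≤ 0.4439` (M5-2d: 78).  Reading (B′) (model-normalised `E₂`) is the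
relabelling rider of IR-50-1's docstring with `5.67·10⁵ ↦ 361`: (WS1⁸²ᴸ) then reads `ρ ≤ ℓ`.  WHAT THESE SENTENCES DESCRIBE (OWNER
t4-ne7b-p1 g52, R-OWNER-52-1 (3); refuter v22 S-v22-1): the WINDOW LEMMAS of this file — `volumeDisplaysS82(L)_of_log_eq_of_inInterval` at the threshold
`ellVolS82(L)`; the per-cube one (`u := log Λ = uvol …`, `Γ := 1 + β₀`, `j := jvol82 d (1+β₀)`) is consumed on the M5-2e road by the
custodian leaf-03's IR-51-2 W5∕W6 `HistoryRealiseCellsRunAssemblyWTVSLWP82` ∕ `…LWKP82` (`HistReadDataLW.toLP82` with weight letter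
`wV K := cvol82 d (jvol82 d (1+β₀)) (1+β₀)`, `nonempty_countRoadWitnessT3bWTVSL_of_histReadingLW82 ∕ …LWD82 ∕ …LWK82`) — a mixed-currency
window on which NO census sentence is booked (its (WS1⁸²) root `(6·collar82 d·cΛ∕E₂)^{1∕κ₂}`, `1 + κ₂ = r·q′`, is certified nowhere); the
(WS1⁸²ᴸ) «NIL AT RATIO ONE, THIN» sentence above BOOKS THE LATTICE-UNIT LEMMA `volumeDisplaysS82L_of_log_eq_of_inInterval` at `ellVolS82L`
(currency (B) of R-OWNER-49-2; OWNER RULING R-OWNER-52-3 on this lineage's question Q-ne7bleaf06-g37-1), whose consumer is commissioned by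
INTERFACE REQUEST IR-52-1 «THE LATTICE-UNIT ROAD» (custodian record `HistReadDataLWL` with `hΛL : log Λ = uvolL cΛ M d g R K t`, embedding
`toLP82L` at `wV := cvol82 d (jvol82 d ((1+β₀)·L^d)) ((1+β₀)·L^d)` fed by §3's fillers, terminal `continuumYM4Torus_of_histReadingLWL_fsc`) and
not yet in the tree at this edition — equivalently how small the proof's implicit `γ₀` in `ForSmallCouplings` is against print's rounding
threshold `e^{−ℓ⋆∕2}`; NEVER a terminal statement: the `…_fsc` theorems of record are window-blind (no `ellVol*` ∕ `jvol*` letter in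
their types) and hold through the per-cube road as well (W5∕W6's `type_of%` certificates).

HONEST SCOPE.  Instantiation over OUR carriers; the windows are HYPOTHESIS shapes (smallness of OUR letters); the three constants are
the OWNER's bookkeeping constants named BY NAME and valued nowhere here; nothing of H3 ∕ (B) ∕ BetaPertH is discharged; the census
readings are the OWNER's rulings, not kernel facts.  Nothing of Bałaban's is asserted or contested.  NE7b NOT PRINTED ∕ NOT PROVED;
spine 0∕9; rung (B)+1 on a FINITE torus — NOT infinite volume, NOT the mass gap, NOT Clay.  HONEST DEPENDENCY (cell): continuum YM
on T⁴ ⇐ BetaPertH ∧ nine spine estimates (0/9 proved); BetaPertH ⇐ (D1) ∧ (D4) ∧ CAP+tail; G-an2-4 gates asym, D1 and NE2/3/4.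
This file changes none of it.
-/

open Literature.MathematicalPhysics.QuantumFieldTheory.Balaban1983to89
open T4PersistenceDictionary T4PrintedShapeBanking T4Continuum
open Summit.QuantumFields.BalabanUV.T4Continuum.HistoryConstants
open Summit.QuantumFields.BalabanUV.T4Continuum.HistoryBankingSharpShares
open Summit.QuantumFields.BalabanUV.T4Continuum.HistoryBankingVolumeWindow
open Summit.QuantumFields.BalabanUV.T4Continuum.HistoryBankingVolumeWindowLattice
open Summit.QuantumFields.BalabanUV.T4Continuum.HistoryBankingVolumeWindowCollar
open Summit.QuantumFields.BalabanUV.T4Continuum.HistoryBankingAnchors82 (collar82 feed82 collar82_pos)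
open Summit.QuantumFields.BalabanUV.T4Continuum.HistoryBankingShrunkLedger82 (cvol82 cvol82_pos)

namespace Summit.QuantumFields.BalabanUV.T4Continuum.HistoryBankingVolumeWindowShrunk82

noncomputable section

/-! ## §1 Letters of record: the lag `jvol82`, the bundle `VolumeDisplaysS82`, the thresholds `ellVolS82` ∕ `ellVolS82L` -/
section Letters

/-- **M5-2e's LAG OF RECORD** `jvol82 d Γ = jlag (feed82 d) Γ`, the least lag with `feed82 d·Γ ≤ 2^j∕2` (desk: `66` at `d = 4`,
`Γ = 13⁴(1+β₀)`, `1 + β₀ ≤ 1.44`; symbolic here). [folklore] -/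
def jvol82 (d : ℕ) (Γ : ℝ) : ℕ := jlag (feed82 d) Γ

/-- `1 ≤ jvol82 d Γ`. [folklore] -/
theorem one_le_jvol82 (d : ℕ) (Γ : ℝ) : 1 ≤ jvol82 d Γ := one_le_jlag _ _

/-- `feed82 d·Γ ≤ 2^{jvol82 d Γ}∕2` — (E4)'s `hsmall` is an identity of the lag. [folklore] -/
theorem hsmall_jvol82 (d : ℕ) (Γ : ℝ) : feed82 d * Γ ≤ 2 ^ jvol82 d Γ / 2 := hsmall_jlag _ _

/-- the collar of record is nonnegative: `0 ≤ 6·collar82 d`. [folklore] -/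
theorem six_collar82_nonneg (d : ℕ) : (0 : ℝ) ≤ 6 * collar82 d := by have := collar82_pos d; positivity

/-- **M5-2e's VOLUME BINDERS, BUNDLED** — the instance `σ := 6·collar82 d`, `c := feed82 d` of part 1's `VolumeDisplaysP`: the
projections are (E4) `shrunk82_volume_le_lifeCost`'s `hu ∕ hΓ0 ∕ hΓ ∕ hj1 ∕ hsmall ∕ huS ∕ huE₂ ∕ huE₃` VERBATIM and in order. [folklore] -/
abbrev VolumeDisplaysS82 (C : T4PrintedShapeBanking.Consts) (d K : ℕ) (R : ℕ → ℕ) (u : ℕ → ℝ) (Γ : ℝ) (j : ℕ) : Prop :=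
  VolumeDisplaysP C d K R u Γ j (6 * collar82 d) (feed82 d)

/-- **THE PER-CUBE THRESHOLD OF RECORD** `ellVolS82 C d κ₂ κᵥ cΛ θᵥ Γ j := ellVolP C d κ₂ κᵥ cΛ θᵥ (cvol82 d j Γ) (6·collar82 d)` (read
at `Γ := 1 + β₀`, `j := jvol82 d (1+β₀)`). [folklore] -/
abbrev ellVolS82 (C : T4PrintedShapeBanking.Consts) (d κ₂ κᵥ : ℕ) (cΛ θv Γ : ℝ) (j : ℕ) : ℝ :=
  ellVolP C d κ₂ κᵥ cΛ θv (cvol82 d j Γ) (6 * collar82 d)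

/-- **THE LATTICE THRESHOLD OF RECORD** `ellVolS82L … := ellVolPL … (cvol82 d j Γ) (6·collar82 d)` (read at `Γ := (1+β₀)·L^d`,
`j := jvol82 d Γ`). [folklore] -/
abbrev ellVolS82L (C : T4PrintedShapeBanking.Consts) (d κ₂ κᵥ : ℕ) (cΛ M : ℝ) (L : ℕ) (θv Γ : ℝ) (j : ℕ) : ℝ :=
  ellVolPL C d κ₂ κᵥ cΛ M L θv (cvol82 d j Γ) (6 * collar82 d)

end Letters

/-! ## §2 Per cube: `u := uvol cΛ g K`, `Γ := 1 + β₀`, `j := jvol82 d (1 + β₀)`, weight `cvol82 d j Γ` -/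
section PerCube

variable {C : T4PrintedShapeBanking.Consts} {d K r κ₂ κᵥ p L j : ℕ} {cΛ θv a β' β₀ γ Γ : ℝ} {g : ℕ → ℝ} {R : ℕ → ℕ}

/-- **`huθS82` PER CUBE**: under the window at weight `cvol82 d j Γ`, `cvol82 d j Γ·uvol … n ≤ θᵥ·p₀(g_n)²` for `n ≤ K`. [folklore] -/
theorem huθS82_uvol (hW : VolumeWindowP C d K r κ₂ κᵥ cΛ θv (cvol82 d j Γ) (6 * collar82 d) g) (n : ℕ) (hn : n ≤ K) :
    cvol82 d j Γ * uvol cΛ g K n ≤ θv * p0Profile C.A₀ C.p₀ (g n) ^ 2 := huθP_uvol hW n hn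

/-- **THE EIGHT BINDERS DISCHARGED PER CUBE** (window at collar `6·collar82 d`, any slack weight `a`): (2.7)'s consequence, signs, the
lower (2.5) member ⊢ `VolumeDisplaysS82 C d K R (uvol cΛ g K) (1+β₀) (jvol82 d (1+β₀))`. [folklore] -/
theorem volumeDisplaysS82_uvol (hmono : ∀ m n, m < n → n ≤ K → ell g n ≤ (1 + β₀) * ell g m) (hβ₀ : 0 ≤ β₀) (hc : 0 ≤ cΛ)
    (hE₂ : 0 ≤ C.E₂) (hE₃ : 0 ≤ C.E₃) (hlow : ∀ t, t ≤ K → ell g t ^ r ≤ (R t : ℝ))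
    (hW : VolumeWindowP C d K r κ₂ κᵥ cΛ θv a (6 * collar82 d) g) :
    VolumeDisplaysS82 C d K R (uvol cΛ g K) (1 + β₀) (jvol82 d (1 + β₀)) := volumeDisplaysP_uvol hmono hβ₀ hc hE₂ hE₃ hlow hW _

/-- the same from (2.7) at any exponent `p ≥ 1` and (2.5) itself. [folklore] -/
theorem volumeDisplaysS82_uvol_of_isRj (hp : 1 ≤ p) (h27 : B14.FlowIneq27 g β' β₀ p K) (hβ₀ : 0 ≤ β₀) (hc : 0 ≤ cΛ)
    (hE₂ : 0 ≤ C.E₂) (hE₃ : 0 ≤ C.E₃) (hRj : ∀ t, t ≤ K → B14.IsRj L r (g t) (R t))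
    (hW : VolumeWindowP C d K r κ₂ κᵥ cΛ θv a (6 * collar82 d) g) :
    VolumeDisplaysS82 C d K R (uvol cΛ g K) (1 + β₀) (jvol82 d (1 + β₀)) := volumeDisplaysP_uvol_of_isRj hp h27 hβ₀ hc hE₂ hE₃ hRj hW _

/-- **THE EIGHT BINDERS FOR A COST PINNED BY `hΛ`, FROM `Flow.InInterval`** (per cube; prefix at `ellVolS82 … (1+β₀) (jvol82 d (1+β₀))`;
the record filler). [folklore] -/
theorem volumeDisplaysS82_of_log_eq_of_inInterval (Fl : Flow) (hI : Fl.InInterval γ K) {Λ : ℕ → ℝ}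
    (hΛ : ∀ t, Real.log (Λ t) = uvol cΛ Fl.g K t) (hexpF : 1 + κ₂ = r * C.q') (hexpV : 1 + κᵥ = 2 * C.p₀) (hκ₂ : 1 ≤ κ₂)
    (hκᵥ : 1 ≤ κᵥ) (hc : 0 ≤ cΛ) (hE₂ : 0 < C.E₂) (hE₃ : 0 < C.E₃) (hθ : 0 < θv) (hA₀ : C.A₀ ≠ 0) (hβ₀ : 0 ≤ β₀) (hp : 1 ≤ p)
    (h27 : B14.FlowIneq27 Fl.g β' β₀ p K) (hRj : ∀ t, t ≤ K → B14.IsRj L r (Fl.g t) (R t))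
    (hγ : γ ≤ Real.exp (-(ellVolS82 C d κ₂ κᵥ cΛ θv (1 + β₀) (jvol82 d (1 + β₀)) / 2))) :
    VolumeDisplaysS82 C d K R (fun t => Real.log (Λ t)) (1 + β₀) (jvol82 d (1 + β₀)) :=
  volumeDisplaysP_of_log_eq_of_inInterval Fl hI hΛ hexpF hexpV hκ₂ hκᵥ hc hE₂ hE₃ hθ hA₀ (cvol82_pos d _ (by linarith)).le
    (six_collar82_nonneg d) hβ₀ hp h27 hRj hγ _

/-- **`huθS82` OVER EVENTS FROM `Flow.InInterval`, GUARDED SHAPE** (IR-51-1 (ii) verbatim: `∀ e ∈ E, (sh e).kind = 0 → (sh e).step ≤ K →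
cvol82 d j Γ * u (sh e).step ≤ θᵥ * p₀(g (sh e).step)²` at `u := log Λ`, `Γ := 1 + β₀`, `j := jvol82 d (1+β₀)`). [folklore] -/
theorem huθS82_events_of_log_eq_of_inInterval (Fl : Flow) (hI : Fl.InInterval γ K) {Λ : ℕ → ℝ}
    (hΛ : ∀ t, Real.log (Λ t) = uvol cΛ Fl.g K t) (hexpF : 1 + κ₂ = r * C.q') (hexpV : 1 + κᵥ = 2 * C.p₀) (hκ₂ : 1 ≤ κ₂)
    (hκᵥ : 1 ≤ κᵥ) (hc : 0 ≤ cΛ) (hE₂ : 0 < C.E₂) (hE₃ : 0 < C.E₃) (hθ : 0 < θv) (hA₀ : C.A₀ ≠ 0) (hβ₀ : 0 ≤ β₀)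
    (hγ : γ ≤ Real.exp (-(ellVolS82 C d κ₂ κᵥ cΛ θv (1 + β₀) (jvol82 d (1 + β₀)) / 2))) {ε : Type*} (sh : ε → PEv) (E : Finset ε) :
    ∀ e ∈ E, (sh e).kind = 0 → (sh e).step ≤ K →
      cvol82 d (jvol82 d (1 + β₀)) (1 + β₀) * Real.log (Λ (sh e).step) ≤ θv * p0Profile C.A₀ C.p₀ (Fl.g (sh e).step) ^ 2 :=
  huθP_events_of_log_eq_of_inInterval Fl hI hΛ hexpF hexpV hκ₂ hκᵥ hc hE₂ hE₃ hθ hA₀ (cvol82_pos d _ (by linarith)).le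
    (six_collar82_nonneg d) hγ sh E

/-- **`huθS82` AT THE BIRTHS FROM `Flow.InInterval`, WITNESS SHAPE** ((E5)'s `huθ` binder ∕ the L-record's `huV` field: `hsteps` separately,
e.g. `HistoryBankingVolumeSupply.births_le_of_step_le`; no guard in the conclusion). [folklore] -/
theorem huθS82_births_of_log_eq_of_inInterval (Fl : Flow) (hI : Fl.InInterval γ K) {Λ : ℕ → ℝ}
    (hΛ : ∀ t, Real.log (Λ t) = uvol cΛ Fl.g K t) (hexpF : 1 + κ₂ = r * C.q') (hexpV : 1 + κᵥ = 2 * C.p₀) (hκ₂ : 1 ≤ κ₂)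
    (hκᵥ : 1 ≤ κᵥ) (hc : 0 ≤ cΛ) (hE₂ : 0 < C.E₂) (hE₃ : 0 < C.E₃) (hθ : 0 < θv) (hA₀ : C.A₀ ≠ 0) (hβ₀ : 0 ≤ β₀)
    (hγ : γ ≤ Real.exp (-(ellVolS82 C d κ₂ κᵥ cΛ θv (1 + β₀) (jvol82 d (1 + β₀)) / 2))) {ε : Type*} (sh : ε → PEv) (E : Finset ε)
    (hsteps : ∀ e ∈ E, (sh e).kind = 0 → (sh e).step ≤ K) :
    ∀ e ∈ E, (sh e).kind = 0 →
      cvol82 d (jvol82 d (1 + β₀)) (1 + β₀) * Real.log (Λ (sh e).step) ≤ θv * p0Profile C.A₀ C.p₀ (Fl.g (sh e).step) ^ 2 :=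
  huθP_births_of_log_eq_of_inInterval Fl hI hΛ hexpF hexpV hκ₂ hκᵥ hc hE₂ hE₃ hθ hA₀ (cvol82_pos d _ (by linarith)).le
    (six_collar82_nonneg d) hγ sh E hsteps

end PerCube

/-! ## §3 Lattice units: `u := uvolL cΛ M d g R K`, `Γ := (1+β₀)·L^d`, `j := jvol82 d Γ`, weight `cvol82 d j Γ` -/
section Lattice

variable {C : T4PrintedShapeBanking.Consts} {d K r κ₂ κᵥ p L j : ℕ} {cΛ M θv a β' β'' β₀ β₀'' γ Γ : ℝ} {g : ℕ → ℝ} {R : ℕ → ℕ}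

/-- **`huθS82` IN LATTICE UNITS**: under the lattice window at weight `cvol82 d j Γ` (`Γ, cΛ, M ≥ 0`, upper (2.5) member),
`cvol82 d j Γ·uvolL … n ≤ θᵥ·p₀(g_n)²`, `n ≤ K`. [folklore] -/
theorem huθS82L_uvolL (hW : VolumeWindowPL C d K r κ₂ κᵥ cΛ M L θv (cvol82 d j Γ) (6 * collar82 d) g) (hΓ : 0 ≤ Γ) (hc : 0 ≤ cΛ)
    (hM : 0 ≤ M) (hup : ∀ n, n ≤ K → (R n : ℝ) ≤ L * ell g n ^ r) (n : ℕ) (hn : n ≤ K) :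
    cvol82 d j Γ * uvolL cΛ M d g R K n ≤ θv * p0Profile C.A₀ C.p₀ (g n) ^ 2 :=
  huθPL_uvolL hW hc hM (cvol82_pos d j hΓ).le hup n hn

/-- **THE EIGHT BINDERS DISCHARGED IN LATTICE UNITS** (window at collar `6·collar82 d`, any slack weight `a`):
`VolumeDisplaysS82 C d K R (uvolL cΛ M d g R K) ((1+β₀)·L^d) (jvol82 d ((1+β₀)·L^d))`. [folklore] -/
theorem volumeDisplaysS82L_uvolL (hmono : ∀ m n, m < n → n ≤ K → ell g n ≤ (1 + β₀) * ell g m)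
    (hRmono : ∀ m n, m < n → n ≤ K → (R n : ℝ) ≤ L * R m) (hβ₀ : 0 ≤ β₀) (hc : 0 ≤ cΛ) (hM : 0 ≤ M) (hL : 1 ≤ L)
    (hE₂ : 0 ≤ C.E₂) (hE₃ : 0 ≤ C.E₃) (hlow : ∀ t, t ≤ K → ell g t ^ r ≤ (R t : ℝ))
    (hW : VolumeWindowPL C d K r κ₂ κᵥ cΛ M L θv a (6 * collar82 d) g) :
    VolumeDisplaysS82 C d K R (uvolL cΛ M d g R K) ((1 + β₀) * L ^ d) (jvol82 d ((1 + β₀) * L ^ d)) :=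
  volumeDisplaysPL_uvolL hmono hRmono hβ₀ hc hM hL hE₂ hE₃ hlow hW _

/-- the same from (2.7) at any exponent `p ≥ 1`, (2.9) and (2.5) itself. [folklore] -/
theorem volumeDisplaysS82L_uvolL_of_isRj (hp : 1 ≤ p) (h27 : B14.FlowIneq27 g β' β₀ p K)
    (h29 : B14FlowStep.FlowIneq29 R g L β'' β₀'' K) (hβ₀ : 0 ≤ β₀) (hc : 0 ≤ cΛ) (hM : 0 ≤ M) (hL : 1 ≤ L) (hE₂ : 0 ≤ C.E₂)
    (hE₃ : 0 ≤ C.E₃) (hRj : ∀ t, t ≤ K → B14.IsRj L r (g t) (R t))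
    (hW : VolumeWindowPL C d K r κ₂ κᵥ cΛ M L θv a (6 * collar82 d) g) :
    VolumeDisplaysS82 C d K R (uvolL cΛ M d g R K) ((1 + β₀) * L ^ d) (jvol82 d ((1 + β₀) * L ^ d)) :=
  volumeDisplaysPL_uvolL_of_isRj hp h27 h29 hβ₀ hc hM hL hE₂ hE₃ hRj hW _

/-- **THE EIGHT BINDERS IN LATTICE UNITS FOR A COST PINNED BY `hΛL`, FROM `Flow.InInterval`** (prefix at
`ellVolS82L … ((1+β₀)L^d) (jvol82 d ((1+β₀)L^d))`). [folklore] -/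
theorem volumeDisplaysS82L_of_log_eq_of_inInterval (Fl : Flow) (hI : Fl.InInterval γ K) {Λ : ℕ → ℝ}
    (hΛ : ∀ t, Real.log (Λ t) = uvolL cΛ M d Fl.g R K t) (hexpF : 1 + κ₂ = r * (C.q' - d)) (hdq : d ≤ C.q')
    (hexpV : 1 + r * d + κᵥ = 2 * C.p₀) (hκ₂ : 1 ≤ κ₂) (hκᵥ : 1 ≤ κᵥ) (hc : 0 ≤ cΛ) (hM : 0 ≤ M) (hL : 1 ≤ L)
    (hE₂ : 0 < C.E₂) (hE₃ : 0 < C.E₃) (hθ : 0 < θv) (hA₀ : C.A₀ ≠ 0) (hβ₀ : 0 ≤ β₀) (hp : 1 ≤ p)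
    (h27 : B14.FlowIneq27 Fl.g β' β₀ p K) (h29 : B14FlowStep.FlowIneq29 R Fl.g L β'' β₀'' K)
    (hRj : ∀ t, t ≤ K → B14.IsRj L r (Fl.g t) (R t))
    (hγ : γ ≤ Real.exp (-(ellVolS82L C d κ₂ κᵥ cΛ M L θv ((1 + β₀) * L ^ d) (jvol82 d ((1 + β₀) * L ^ d)) / 2))) :
    VolumeDisplaysS82 C d K R (fun t => Real.log (Λ t)) ((1 + β₀) * L ^ d) (jvol82 d ((1 + β₀) * L ^ d)) :=
  volumeDisplaysPL_of_log_eq_of_inInterval Fl hI hΛ hexpF hdq hexpV hκ₂ hκᵥ hc hM hL hE₂ hE₃ hθ hA₀ (cvol82_pos d _ (by positivity)).le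
    (six_collar82_nonneg d) hβ₀ hp h27 h29 hRj hγ _

/-- **`huθS82` OVER EVENTS FROM `Flow.InInterval` IN LATTICE UNITS, GUARDED SHAPE** (IR-51-1 (ii) at the lattice letters). [folklore] -/
theorem huθS82L_events_of_log_eq_of_inInterval (Fl : Flow) (hI : Fl.InInterval γ K) {Λ : ℕ → ℝ}
    (hΛ : ∀ t, Real.log (Λ t) = uvolL cΛ M d Fl.g R K t) (hexpF : 1 + κ₂ = r * (C.q' - d)) (hdq : d ≤ C.q')
    (hexpV : 1 + r * d + κᵥ = 2 * C.p₀) (hκ₂ : 1 ≤ κ₂) (hκᵥ : 1 ≤ κᵥ) (hc : 0 ≤ cΛ) (hM : 0 ≤ M) (hL : 1 ≤ L)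
    (hE₂ : 0 < C.E₂) (hE₃ : 0 < C.E₃) (hθ : 0 < θv) (hA₀ : C.A₀ ≠ 0) (hβ₀ : 0 ≤ β₀)
    (hRj : ∀ t, t ≤ K → B14.IsRj L r (Fl.g t) (R t))
    (hγ : γ ≤ Real.exp (-(ellVolS82L C d κ₂ κᵥ cΛ M L θv ((1 + β₀) * L ^ d) (jvol82 d ((1 + β₀) * L ^ d)) / 2)))
    {ε : Type*} (sh : ε → PEv) (E : Finset ε) :
    ∀ e ∈ E, (sh e).kind = 0 → (sh e).step ≤ K →
      cvol82 d (jvol82 d ((1 + β₀) * L ^ d)) ((1 + β₀) * L ^ d) * Real.log (Λ (sh e).step) ≤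
        θv * p0Profile C.A₀ C.p₀ (Fl.g (sh e).step) ^ 2 :=
  huθPL_events_of_log_eq_of_inInterval Fl hI hΛ hexpF hdq hexpV hκ₂ hκᵥ hc hM hL hE₂ hE₃ hθ hA₀ (cvol82_pos d _ (by positivity)).le
    (six_collar82_nonneg d) hRj hγ sh E

/-- **`huθS82` AT THE BIRTHS FROM `Flow.InInterval` IN LATTICE UNITS, WITNESS SHAPE** (`hsteps` separately). [folklore] -/
theorem huθS82L_births_of_log_eq_of_inInterval (Fl : Flow) (hI : Fl.InInterval γ K) {Λ : ℕ → ℝ}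
    (hΛ : ∀ t, Real.log (Λ t) = uvolL cΛ M d Fl.g R K t) (hexpF : 1 + κ₂ = r * (C.q' - d)) (hdq : d ≤ C.q')
    (hexpV : 1 + r * d + κᵥ = 2 * C.p₀) (hκ₂ : 1 ≤ κ₂) (hκᵥ : 1 ≤ κᵥ) (hc : 0 ≤ cΛ) (hM : 0 ≤ M) (hL : 1 ≤ L)
    (hE₂ : 0 < C.E₂) (hE₃ : 0 < C.E₃) (hθ : 0 < θv) (hA₀ : C.A₀ ≠ 0) (hβ₀ : 0 ≤ β₀)
    (hRj : ∀ t, t ≤ K → B14.IsRj L r (Fl.g t) (R t))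
    (hγ : γ ≤ Real.exp (-(ellVolS82L C d κ₂ κᵥ cΛ M L θv ((1 + β₀) * L ^ d) (jvol82 d ((1 + β₀) * L ^ d)) / 2)))
    {ε : Type*} (sh : ε → PEv) (E : Finset ε) (hsteps : ∀ e ∈ E, (sh e).kind = 0 → (sh e).step ≤ K) :
    ∀ e ∈ E, (sh e).kind = 0 →
      cvol82 d (jvol82 d ((1 + β₀) * L ^ d)) ((1 + β₀) * L ^ d) * Real.log (Λ (sh e).step) ≤
        θv * p0Profile C.A₀ C.p₀ (Fl.g (sh e).step) ^ 2 :=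
  huθPL_births_of_log_eq_of_inInterval Fl hI hΛ hexpF hdq hexpV hκ₂ hκᵥ hc hM hL hE₂ hE₃ hθ hA₀ (cvol82_pos d _ (by positivity)).le
    (six_collar82_nonneg d) hRj hγ sh E hsteps

end Lattice

end

end Summit.QuantumFields.BalabanUV.T4Continuum.HistoryBankingVolumeWindowShrunk82
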